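import Literature.Computability.AlgebraicComplexity.DDS21BloatedRatioDeborder
import HarnessLib

/-!
# Dutta–Dwivedi–Saxena 2021, §3: the `ε → 0` calculus of EXACT fractions over `F(ε)(x)`

Topic `Literature/Computability/AlgebraicComplexity` (cell `val-lit`, row X2-DDS21, brick "B4c (E1)"
of the `DDS2021_thm_3_2` programme, frame RULING (132)(a) "R1 = exact objects": the DiDIL terms
`T_{i,j}` and the sums `g_j` are kept as honest elements of the rational function field
`F(ε)(x) = Frac(F(ε)[x])`, and what the printed induction calls "`lim_{ε→0}` exists" /
"`val_ε ≥ 0`" is the predicate below). Source: P. Dutta, P. Dwivedi, N. Saxena, *Demystifying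
the border of depth-3 algebraic circuits*, FOCS 2021 [DuttaDwivediSaxena2022], held full version
`paper:galaxy-pdf-7641649743695546420` (chunk `pNNNN.txt`, printed line `Lnnn`).

Throughout `K = F(ε) = RatFunc F`, `A = F[ε] = F[X]`, `ι = algebraMap F[X] (RatFunc F)`,
`L = FractionRing (MvPolynomial σ (RatFunc F))` ("`F(ε)(x)`", the ambient field of DDS §3:
"`R(x)` where `R = F[z]/⟨z^d⟩`"-free version, p0028 L755) and `L₀ = FractionRing (MvPolynomial σ F)`
("`F(x)`", where the limits `f_j`, `t_{k-j,j}` live, p0029 L777–779, p0030 L799–805).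

## Contents (definitions with bodies + proved API; no named facts)

* `DDS2021.redZero F σ : F[ε][x] →+* F[x]` — reduction at `ε = 0` (coefficientwise
  `Polynomial.constantCoeff`); `DDS2021.intToFrac F σ : F[ε][x] →+* L` — the integral models inside
  `F(ε)(x)`; `DDS2021.limToFrac F σ : F[x] →+* L₀`. Both embeddings are injective.
* `DDS2021.EpsLim T r` — "`T ∈ F(ε)(x)` is `ε`-integral and `lim_{ε→0} T = r ∈ F(x)`": `T = M/E`
  with `M, E ∈ F[ε][x]`, `E(ε=0) ≠ 0`, and `r = M(0)/E(0)`.  This is the hypothesis shape of the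
  tree's `DDS2021.deborder_gen_one` ("`U·P·E = M·V·Q`, `red E ≠ 0`") and the honest reading of
  DDS's "`T =: ε^{a}·T̃` … `lim_{ε→0} T̃ =: t` exists" (p0027 L729–733, p0028 L760, p0030 L808–810)
  for RATIONAL FUNCTIONS: the Gauss (`ε`-adic) valuation ring of `F(ε)(x)` and its residue map.
  `DDS2021.IsEpsInt T := ∃ r, EpsLim T r`, with the chosen limit `IsEpsInt.lim`.
* WELL-DEFINEDNESS `EpsLim.unique` (two models `M/E = M'/E'` give `M·E' = M'·E` over `F[ε]` by
  injectivity of `F[ε][x] → F(ε)(x)`, hence proportional reductions), and `epsLim_of_model` (ANY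
  model computes the limit).
* CLOSURE: `EpsLim.add/mul/neg/sub/pow/nsmul`, `epsLim_sum/prod` (the valuation ring is a ring and
  `lim` is a ring map on it), `EpsLim.inv/div` by `ε`-UNITS = elements whose limit is NONZERO (the
  DIVIDE step "`∂_z(T_{i,j}/T̃_{k-j,j})`" divides by the normalised term whose limit `t_{k-j,j} ≠ 0`,
  p0030 L808–812, p0031 L815–820); constants `epsLim_intToFrac` (`G ↦ G(0)`), scalars
  `epsLim_C_algebraMap`, `epsLim_eps` (`ε ↦ 0`), `epsLim_C_div` (`p(ε)/q(ε) ↦ p(0)/q(0)` when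
  `q(0) ≠ 0`).
* LINKS to the polynomial layer: `epsLim_algebraMap_of_isEpsApprox` (Def. 2.1: `g = f + ε·S`
  gives `lim g = f`), `EpsLim.exists_eq_C_mul_of_normalForm` (for an `ε`-normal form `c·Ĝ`,
  `Ĝ(0) ≠ 0`, the limit is `u·Ĝ(0)`, `u ≠ 0` iff the limit is nonzero — the tree's
  `exists_limit_ratio`), `IsEpsInt.exists_ord_of_normalForm` ("it must happen that
  `val_ε(…) ≥ 0`", p0027 L733–735 — the tree's `exists_ord_of_C_mul_map_eq_map`).

What is NOT here: the Euler/`∂_z` step (closure of `EpsLim` under the graded derivation lives with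
the graded-fraction toolkit `DDS21GradedFractions.lean`, brick B4a) and every `Σ∧Σ`/`ΠΣ` shape
statement (bricks B4b/B4c proper).

Honest framing: elementary Gauss-lemma bookkeeping; nothing here bears on VP versus VNP, which is
NOT proved; `DDS2021_thm_3_2` and `DDS2021_thm_5_1` remain named facts.

## References

* [DuttaDwivediSaxena2022] P. Dutta, P. Dwivedi, N. Saxena, *Demystifying the border of depth-3
  algebraic circuits*, Proc. 62nd FOCS (2021), IEEE 2022, 92–103; full version
  `paper:galaxy-pdf-7641649743695546420`: §2 "Valuation" p0015 L407–410, Def. 2.1 p0016 L416–419,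
  Claim 3.3 proof p0027 L724–744, p0028 L751–760, Claim 3.4 p0029 L772–785, induction hypotheses
  p0030 L799–812, Claim 3.5 p0031 L815–834, Claim 3.8 p0035–p0036 L934–943.
-/

noncomputable section

open MvPolynomial
open scoped BigOperators Polynomial

namespace Literature.Computability.AlgebraicComplexity

namespace DDS2021

section Plumbing

variable (F : Type*) [Field F] (σ : Type*)

/-- **Reduction at `ε = 0`** of an integral model `G ∈ F[ε][x]`: the coefficientwise constant term,
`G ↦ G|_{ε=0}` ("`lim_{ε→0}`" of a polynomial with coefficients in `F[ε]`, Def. 2.1).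
[cite: DuttaDwivediSaxena2022, Def. 2.1 (full version p0016 L416–419)] -/
def redZero : MvPolynomial σ F[X] →+* MvPolynomial σ F :=
  map (Polynomial.constantCoeff : F[X] →+* F)

/-- **Integral models inside `F(ε)(x)`**: the composite embedding
`F[ε][x] → F(ε)[x] → Frac(F(ε)[x])`. [cite: DuttaDwivediSaxena2022, §3 proof of Claim 3.3 (full version p0027 L729–733)] -/
def intToFrac : MvPolynomial σ F[X] →+* FractionRing (MvPolynomial σ (RatFunc F)) :=
  (algebraMap (MvPolynomial σ (RatFunc F)) (FractionRing (MvPolynomial σ (RatFunc F)))).comp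
    (map (algebraMap F[X] (RatFunc F)))

/-- **Limits inside `F(x)`**: the embedding `F[x] → Frac(F[x])` (where "`Φ(f₀)/t ∈ F(x)[[z]]`"
and the `f_j` live). [cite: DuttaDwivediSaxena2022, Claim 3.4 proof (full version p0029 L777–779)] -/
def limToFrac : MvPolynomial σ F →+* FractionRing (MvPolynomial σ F) :=
  algebraMap (MvPolynomial σ F) (FractionRing (MvPolynomial σ F))

variable {F σ}

/-- Unfolding `redZero`. [cite: DuttaDwivediSaxena2022, Def. 2.1 (full version p0016 L416–419)] -/
theorem redZero_apply (G : MvPolynomial σ F[X]) :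
    redZero F σ G = map (Polynomial.constantCoeff : F[X] →+* F) G := rfl

/-- Unfolding `intToFrac`. [cite: DuttaDwivediSaxena2022, §2 "Valuation" (full version p0015 L407–410)] -/
theorem intToFrac_apply (G : MvPolynomial σ F[X]) :
    intToFrac F σ G = algebraMap (MvPolynomial σ (RatFunc F))
      (FractionRing (MvPolynomial σ (RatFunc F))) (map (algebraMap F[X] (RatFunc F)) G) := rfl

/-- Unfolding `limToFrac`. [cite: DuttaDwivediSaxena2022, §2 "Valuation" (full version p0015 L407–410)] -/
theorem limToFrac_apply (f : MvPolynomial σ F) :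
    limToFrac F σ f = algebraMap (MvPolynomial σ F) (FractionRing (MvPolynomial σ F)) f := rfl

/-- `F[ε][x] → F(ε)(x)` is injective (both `F[ε] ⊂ F(ε)` and a domain into its fraction field are).
(folklore) [cite: DuttaDwivediSaxena2022, §2 "Valuation" (full version p0015 L407–410)] -/
theorem intToFrac_injective : Function.Injective (intToFrac F σ) :=
  (IsFractionRing.injective (MvPolynomial σ (RatFunc F))
      (FractionRing (MvPolynomial σ (RatFunc F)))).comp
    (map_injective _ (RatFunc.algebraMap_injective F))

/-- `F[x] → F(x)` is injective. (folklore) [cite: DuttaDwivediSaxena2022, §2 "Valuation" (full version p0015 L407–410)] -/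
theorem limToFrac_injective : Function.Injective (limToFrac F σ) :=
  IsFractionRing.injective (MvPolynomial σ F) (FractionRing (MvPolynomial σ F))

/-- Nonzero integral models are nonzero in `F(ε)(x)` (folklore). [cite: DuttaDwivediSaxena2022, §2 "Valuation" (full version p0015 L407–410)] -/
theorem intToFrac_ne_zero {G : MvPolynomial σ F[X]} (hG : G ≠ 0) : intToFrac F σ G ≠ 0 :=
  fun h => hG (intToFrac_injective (by rw [h, map_zero]))

/-- Nonzero polynomials are nonzero in `F(x)` (folklore). [cite: DuttaDwivediSaxena2022, §2 "Valuation" (full version p0015 L407–410)] -/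
theorem limToFrac_ne_zero {f : MvPolynomial σ F} (hf : f ≠ 0) : limToFrac F σ f ≠ 0 :=
  fun h => hf (limToFrac_injective (by rw [h, map_zero]))

/-- A model with nonzero reduction is nonzero (folklore). [cite: DuttaDwivediSaxena2022, Def. 2.1 (full version p0016 L416–419)] -/
theorem ne_zero_of_redZero_ne_zero {G : MvPolynomial σ F[X]} (hG : redZero F σ G ≠ 0) : G ≠ 0 :=
  fun h => hG (by rw [h, map_zero])

/-- Scalars divide inside `F(ε)(x)`: `C (c/d) = C c / C d` read in the fraction field.
(folklore) [cite: DuttaDwivediSaxena2022, §2 "Valuation" (full version p0015 L407–410)] -/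
theorem algebraMap_C_div (c d : RatFunc F) :
    algebraMap (MvPolynomial σ (RatFunc F)) (FractionRing (MvPolynomial σ (RatFunc F)))
        (C (c / d)) =
      algebraMap (MvPolynomial σ (RatFunc F)) (FractionRing (MvPolynomial σ (RatFunc F))) (C c) /
        algebraMap (MvPolynomial σ (RatFunc F)) (FractionRing (MvPolynomial σ (RatFunc F)))
          (C d) := by
  set φ : RatFunc F →+* FractionRing (MvPolynomial σ (RatFunc F)) :=
    (algebraMap (MvPolynomial σ (RatFunc F)) (FractionRing (MvPolynomial σ (RatFunc F)))).comp C
    with hφ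
  have e := map_div₀ φ c d
  have e1 : ∀ x : RatFunc F, φ x = algebraMap (MvPolynomial σ (RatFunc F))
      (FractionRing (MvPolynomial σ (RatFunc F))) (C x) := fun x => by
    rw [hφ, RingHom.comp_apply]
  rwa [e1, e1, e1] at e

/-- Two integral models of the same fraction cross-multiply to the same polynomial over `F[ε]`:
`T·E = M`, `T·E' = M'` in `F(ε)(x)` force `M·E' = M'·E` in `F[ε][x]`.
[cite: DuttaDwivediSaxena2022, §3 proof of Claim 3.3 (full version p0027 L729–737)] -/
theorem models_cross_eq {T : FractionRing (MvPolynomial σ (RatFunc F))}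
    {M E M' E' : MvPolynomial σ F[X]}
    (h : T * intToFrac F σ E = intToFrac F σ M) (h' : T * intToFrac F σ E' = intToFrac F σ M') :
    M * E' = M' * E := by
  apply intToFrac_injective
  rw [map_mul, map_mul, ← h, ← h']
  ring

end Plumbing

/-! ### `ε`-integral fractions and their limits -/

section Defs

variable {F : Type*} [Field F] {σ : Type*}

/-- **`T ∈ F(ε)(x)` is `ε`-integral with limit `r ∈ F(x)`**: `T = M/E` for integral models
`M, E ∈ F[ε][x]` with `E(ε = 0) ≠ 0`, and `r = M(0)/E(0)` (stated multiplicatively). This is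
"`lim_{ε→0} T` exists (and equals `r`)" for the exact DiDIL objects `T_{i,j}`, `g_j`,
`T̃_{k-j,j}` ("`g_j` approximates `f_j` correctly, i.e. `lim_{ε→0} g_j = f_j`", induction
hypothesis (1); "`T_{k-j,j} =: ε^{a}·T̃` … `lim T̃ =: t_{k-j,j}` exists").
[cite: DuttaDwivediSaxena2022, §3 induction hypotheses (1)–(2) (full version p0030 L799–810); Claim 3.3 proof (p0027 L729–733)] -/
def EpsLim (T : FractionRing (MvPolynomial σ (RatFunc F)))
    (r : FractionRing (MvPolynomial σ F)) : Prop :=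
  ∃ M E : MvPolynomial σ F[X], redZero F σ E ≠ 0 ∧ T * intToFrac F σ E = intToFrac F σ M ∧
    r * limToFrac F σ (redZero F σ E) = limToFrac F σ (redZero F σ M)

/-- **`ε`-integrality** of `T ∈ F(ε)(x)`: "`lim_{ε→0} T` exists" ("`val_ε(T) ≥ 0`" for the Gauss
valuation). [cite: DuttaDwivediSaxena2022, §3 proof of Claim 3.3 "it must happen that val_ε(…) ≥ 0" (full version p0027 L733–735)] -/
def IsEpsInt (T : FractionRing (MvPolynomial σ (RatFunc F))) : Prop :=
  ∃ r, EpsLim T r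

/-- A fraction with a limit is `ε`-integral. [cite: DuttaDwivediSaxena2022, §3 induction hypotheses (1)–(2) (full version p0030 L799–810)] -/
theorem EpsLim.isEpsInt {T : FractionRing (MvPolynomial σ (RatFunc F))}
    {r : FractionRing (MvPolynomial σ F)} (h : EpsLim T r) : IsEpsInt T :=
  ⟨r, h⟩

/-- **The limit of an `ε`-integral fraction** (a choice; unique by `EpsLim.unique`, computed by
any model by `epsLim_of_model`). [cite: DuttaDwivediSaxena2022, §3 induction hypothesis (1) (full version p0030 L799–801)] -/
def IsEpsInt.lim {T : FractionRing (MvPolynomial σ (RatFunc F))} (h : IsEpsInt T) :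
    FractionRing (MvPolynomial σ F) :=
  Classical.choose h

/-- The chosen limit is a limit. [cite: DuttaDwivediSaxena2022, §3 induction hypotheses (1)–(2) (full version p0030 L799–810)] -/
theorem IsEpsInt.epsLim_lim {T : FractionRing (MvPolynomial σ (RatFunc F))} (h : IsEpsInt T) :
    EpsLim T h.lim :=
  Classical.choose_spec h

end Defs

/-! ### Well-definedness -/

section Unique

variable {F : Type*} [Field F] {σ : Type*}
variable {T : FractionRing (MvPolynomial σ (RatFunc F))} {r r' : FractionRing (MvPolynomial σ F)}

/-- **Any model computes the limit**: `T = M/E` with `E(0) ≠ 0` gives `lim T = M(0)/E(0)`.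
[cite: DuttaDwivediSaxena2022, Claim 3.3 proof (full version p0027 L733–737)] -/
theorem epsLim_of_model {M E : MvPolynomial σ F[X]} (hE : redZero F σ E ≠ 0)
    (hT : T * intToFrac F σ E = intToFrac F σ M) :
    EpsLim T (limToFrac F σ (redZero F σ M) / limToFrac F σ (redZero F σ E)) :=
  ⟨M, E, hE, hT, div_mul_cancel₀ _ (limToFrac_ne_zero hE)⟩

/-- A model with unit denominator witnesses `ε`-integrality. [cite: DuttaDwivediSaxena2022, Claim 3.3 proof (full version p0027 L729–737)] -/
theorem isEpsInt_of_model {M E : MvPolynomial σ F[X]} (hE : redZero F σ E ≠ 0)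
    (hT : T * intToFrac F σ E = intToFrac F σ M) : IsEpsInt T :=
  (epsLim_of_model hE hT).isEpsInt

/-- **The limit is well defined**: two models `M/E = M'/E'` of `T` satisfy `M·E' = M'·E` over
`F[ε]` (`models_cross_eq`), hence `M(0)·E'(0) = M'(0)·E(0)` and the two limits agree in `F(x)`.
[cite: DuttaDwivediSaxena2022, Claim 3.3 proof (full version p0027 L729–737); Lemma 2.20 proof (p0024 L1–6)] -/
theorem EpsLim.unique (h : EpsLim T r) (h' : EpsLim T r') : r = r' := by
  obtain ⟨M, E, hE, hT, hr⟩ := h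
  obtain ⟨M', E', hE', hT', hr'⟩ := h'
  have hx := congrArg (redZero F σ) (models_cross_eq hT hT')
  rw [map_mul, map_mul] at hx
  have hne : limToFrac F σ (redZero F σ E) * limToFrac F σ (redZero F σ E') ≠ 0 :=
    mul_ne_zero (limToFrac_ne_zero hE) (limToFrac_ne_zero hE')
  apply mul_right_cancel₀ hne
  calc r * (limToFrac F σ (redZero F σ E) * limToFrac F σ (redZero F σ E'))
      = (r * limToFrac F σ (redZero F σ E)) * limToFrac F σ (redZero F σ E') := by ring
    _ = limToFrac F σ (redZero F σ M * redZero F σ E') := by rw [hr, map_mul]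
    _ = limToFrac F σ (redZero F σ M' * redZero F σ E) := by rw [hx]
    _ = (r' * limToFrac F σ (redZero F σ E')) * limToFrac F σ (redZero F σ E) := by
        rw [map_mul, hr']
    _ = r' * (limToFrac F σ (redZero F σ E) * limToFrac F σ (redZero F σ E')) := by ring

/-- The chosen limit of an `ε`-integral fraction is any of its limits. [cite: DuttaDwivediSaxena2022, Claim 3.3 proof (full version p0027 L729–737)] -/
theorem EpsLim.lim_eq (h : EpsLim T r) : h.isEpsInt.lim = r :=
  h.isEpsInt.epsLim_lim.unique h

/-- Any model computes the limit, equational form. [cite: DuttaDwivediSaxena2022, Claim 3.3 proof (full version p0027 L733–737)] -/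
theorem EpsLim.mul_eq_of_model (h : EpsLim T r) {M E : MvPolynomial σ F[X]}
    (hE : redZero F σ E ≠ 0) (hT : T * intToFrac F σ E = intToFrac F σ M) :
    r * limToFrac F σ (redZero F σ E) = limToFrac F σ (redZero F σ M) := by
  rw [h.unique (epsLim_of_model hE hT), div_mul_cancel₀ _ (limToFrac_ne_zero hE)]

/-- In a model `T = M/E` of an `ε`-integral `T`, the limit is nonzero iff `M(0) ≠ 0`.
[cite: DuttaDwivediSaxena2022, Claim 3.3 proof "If … ≥ 1, then f = 0" (full version p0027 L733–735)] -/
theorem EpsLim.ne_zero_iff_of_model (h : EpsLim T r) {M E : MvPolynomial σ F[X]}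
    (hE : redZero F σ E ≠ 0) (hT : T * intToFrac F σ E = intToFrac F σ M) :
    r ≠ 0 ↔ redZero F σ M ≠ 0 := by
  have key := h.mul_eq_of_model hE hT
  constructor
  · intro hr hM
    rw [hM, map_zero] at key
    exact mul_ne_zero hr (limToFrac_ne_zero hE) key
  · intro hM hr
    rw [hr, zero_mul] at key
    exact limToFrac_ne_zero hM key.symm

end Unique

/-! ### Constants -/

section Constants

variable {F : Type*} [Field F] {σ : Type*}

/-- An integral model is its own model: `lim_{ε→0} G = G(0)`.
[cite: DuttaDwivediSaxena2022, Def. 2.1 (full version p0016 L416–419)] -/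
theorem epsLim_intToFrac (G : MvPolynomial σ F[X]) :
    EpsLim (intToFrac F σ G) (limToFrac F σ (redZero F σ G)) :=
  ⟨G, 1, by rw [map_one]; exact one_ne_zero, by rw [map_one, mul_one],
    by rw [map_one, map_one, mul_one]⟩

/-- `lim 0 = 0`. [cite: DuttaDwivediSaxena2022, Def. 2.1 (full version p0016 L416–419)] -/
theorem epsLim_zero :
    EpsLim (0 : FractionRing (MvPolynomial σ (RatFunc F))) (0 : FractionRing (MvPolynomial σ F)) := by
  have h := epsLim_intToFrac (F := F) (σ := σ) 0
  rwa [map_zero, map_zero, map_zero] at h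

/-- `lim 1 = 1`. [cite: DuttaDwivediSaxena2022, Def. 2.1 (full version p0016 L416–419)] -/
theorem epsLim_one :
    EpsLim (1 : FractionRing (MvPolynomial σ (RatFunc F))) (1 : FractionRing (MvPolynomial σ F)) := by
  have h := epsLim_intToFrac (F := F) (σ := σ) 1
  rwa [map_one, map_one, map_one] at h

/-- A polynomial over `F(ε)` with coefficients in `F[ε]`, read in `F(ε)(x)`, tends to its
reduction. [cite: DuttaDwivediSaxena2022, Def. 2.1 (full version p0016 L416–419)] -/
theorem epsLim_algebraMap_map (G : MvPolynomial σ F[X]) :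
    EpsLim (algebraMap (MvPolynomial σ (RatFunc F)) (FractionRing (MvPolynomial σ (RatFunc F)))
        (map (algebraMap F[X] (RatFunc F)) G))
      (limToFrac F σ (map (Polynomial.constantCoeff : F[X] →+* F) G)) :=
  epsLim_intToFrac G

/-- Scalars `p(ε) ∈ F[ε]` tend to `p(0)`. [cite: DuttaDwivediSaxena2022, §2 "Valuation" (full version p0015 L407–410)] -/
theorem epsLim_C_algebraMap (p : F[X]) :
    EpsLim (algebraMap (MvPolynomial σ (RatFunc F)) (FractionRing (MvPolynomial σ (RatFunc F)))
        (C (algebraMap F[X] (RatFunc F) p)))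
      (limToFrac F σ (C (p.coeff 0))) := by
  have h := epsLim_intToFrac (F := F) (σ := σ) (C p)
  rwa [intToFrac_apply, map_C, redZero_apply, map_C, Polynomial.constantCoeff_apply] at h

/-- `ε → 0`. [cite: DuttaDwivediSaxena2022, Def. 2.1 (full version p0016 L416–419)] -/
theorem epsLim_eps :
    EpsLim (algebraMap (MvPolynomial σ (RatFunc F)) (FractionRing (MvPolynomial σ (RatFunc F)))
        (C (algebraMap F[X] (RatFunc F) Polynomial.X)))
      0 := by
  have h := epsLim_C_algebraMap (F := F) (σ := σ) Polynomial.X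
  rwa [Polynomial.coeff_X_zero, C_0, map_zero] at h

/-- Constants of `F` are their own limits. [cite: DuttaDwivediSaxena2022, Def. 2.1 (full version p0016 L416–419)] -/
theorem epsLim_C (a : F) :
    EpsLim (algebraMap (MvPolynomial σ (RatFunc F)) (FractionRing (MvPolynomial σ (RatFunc F)))
        (C (algebraMap F (RatFunc F) a)))
      (limToFrac F σ (C a)) := by
  have h := epsLim_C_algebraMap (F := F) (σ := σ) (Polynomial.C a)
  rw [Polynomial.coeff_C_zero, RatFunc.algebraMap_C] at h
  rwa [RatFunc.algebraMap_eq_C]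

end Constants

/-! ### Ring closure: the `ε`-integral fractions form a ring and `lim` is a ring map -/

section Ring

variable {F : Type*} [Field F] {σ : Type*}
variable {T T₁ T₂ : FractionRing (MvPolynomial σ (RatFunc F))}
  {r r₁ r₂ : FractionRing (MvPolynomial σ F)}

/-- `lim (T₁ + T₂) = lim T₁ + lim T₂` (models `M₁/E₁ + M₂/E₂ = (M₁E₂ + M₂E₁)/(E₁E₂)`,
`(E₁E₂)(0) = E₁(0)E₂(0) ≠ 0` as `F[x]` is a domain).
[cite: DuttaDwivediSaxena2022, Lemma 2.20 proof (full version p0023 L632–636, p0024 L1–6)] -/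
theorem EpsLim.add (h₁ : EpsLim T₁ r₁) (h₂ : EpsLim T₂ r₂) : EpsLim (T₁ + T₂) (r₁ + r₂) := by
  obtain ⟨M₁, E₁, hE₁, hT₁, hr₁⟩ := h₁
  obtain ⟨M₂, E₂, hE₂, hT₂, hr₂⟩ := h₂
  refine ⟨M₁ * E₂ + M₂ * E₁, E₁ * E₂, ?_, ?_, ?_⟩
  · rw [map_mul]
    exact mul_ne_zero hE₁ hE₂
  · simp only [map_mul, map_add]
    rw [← hT₁, ← hT₂]
    ring
  · simp only [map_mul, map_add]
    rw [← hr₁, ← hr₂]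
    ring

/-- `lim (T₁ · T₂) = lim T₁ · lim T₂`. [cite: DuttaDwivediSaxena2022, Lemma 2.20 proof (full version p0023 L632–636, p0024 L1–6)] -/
theorem EpsLim.mul (h₁ : EpsLim T₁ r₁) (h₂ : EpsLim T₂ r₂) : EpsLim (T₁ * T₂) (r₁ * r₂) := by
  obtain ⟨M₁, E₁, hE₁, hT₁, hr₁⟩ := h₁
  obtain ⟨M₂, E₂, hE₂, hT₂, hr₂⟩ := h₂
  refine ⟨M₁ * M₂, E₁ * E₂, ?_, ?_, ?_⟩
  · rw [map_mul]
    exact mul_ne_zero hE₁ hE₂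
  · simp only [map_mul]
    rw [← hT₁, ← hT₂]
    ring
  · simp only [map_mul]
    rw [← hr₁, ← hr₂]
    ring

/-- `lim (−T) = −lim T`. [cite: DuttaDwivediSaxena2022, Lemma 2.20 proof (full version p0023 L632–636, p0024 L1–6)] -/
theorem EpsLim.neg (h : EpsLim T r) : EpsLim (-T) (-r) := by
  obtain ⟨M, E, hE, hT, hr⟩ := h
  refine ⟨-M, E, hE, ?_, ?_⟩
  · rw [map_neg, ← hT, neg_mul]
  · rw [map_neg, map_neg, ← hr, neg_mul]

/-- `lim (T₁ − T₂) = lim T₁ − lim T₂`. [cite: DuttaDwivediSaxena2022, Lemma 2.20 proof (full version p0023 L632–636, p0024 L1–6)] -/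
theorem EpsLim.sub (h₁ : EpsLim T₁ r₁) (h₂ : EpsLim T₂ r₂) : EpsLim (T₁ - T₂) (r₁ - r₂) := by
  rw [sub_eq_add_neg, sub_eq_add_neg]
  exact h₁.add h₂.neg

/-- `lim (T^n) = (lim T)^n`. [cite: DuttaDwivediSaxena2022, Lemma 2.20 proof (full version p0023 L632–636, p0024 L1–6)] -/
theorem EpsLim.pow (h : EpsLim T r) (n : ℕ) : EpsLim (T ^ n) (r ^ n) := by
  induction n with
  | zero => rw [pow_zero, pow_zero]; exact epsLim_one
  | succ n ih => rw [pow_succ, pow_succ]; exact ih.mul h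

/-- `lim (n • T) = n • lim T`. [cite: DuttaDwivediSaxena2022, Lemma 2.20 proof (full version p0023 L632–636, p0024 L1–6)] -/
theorem EpsLim.nsmul (h : EpsLim T r) (n : ℕ) : EpsLim (n • T) (n • r) := by
  induction n with
  | zero => rw [zero_smul, zero_smul]; exact epsLim_zero
  | succ n ih => rw [succ_nsmul, succ_nsmul]; exact ih.add h

/-- Finite sums. [cite: DuttaDwivediSaxena2022, §3 induction hypothesis (1) "∑ T_{i,j} = g_j" (full version p0030 L799–801)] -/
theorem epsLim_sum {ι : Type*} (s : Finset ι)
    {T : ι → FractionRing (MvPolynomial σ (RatFunc F))} {r : ι → FractionRing (MvPolynomial σ F)}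
    (h : ∀ i ∈ s, EpsLim (T i) (r i)) : EpsLim (∑ i ∈ s, T i) (∑ i ∈ s, r i) := by
  classical
  induction s using Finset.induction_on with
  | empty => rw [Finset.sum_empty, Finset.sum_empty]; exact epsLim_zero
  | insert a s ha ih =>
    rw [Finset.sum_insert ha, Finset.sum_insert ha]
    exact (h a (Finset.mem_insert_self a s)).add
      (ih fun i hi => h i (Finset.mem_insert_of_mem hi))

/-- Finite products. [cite: DuttaDwivediSaxena2022, Lemma 2.20 proof (full version p0023 L632–636, p0024 L1–6)] -/
theorem epsLim_prod {ι : Type*} (s : Finset ι)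
    {T : ι → FractionRing (MvPolynomial σ (RatFunc F))} {r : ι → FractionRing (MvPolynomial σ F)}
    (h : ∀ i ∈ s, EpsLim (T i) (r i)) : EpsLim (∏ i ∈ s, T i) (∏ i ∈ s, r i) := by
  classical
  induction s using Finset.induction_on with
  | empty => rw [Finset.prod_empty, Finset.prod_empty]; exact epsLim_one
  | insert a s ha ih =>
    rw [Finset.prod_insert ha, Finset.prod_insert ha]
    exact (h a (Finset.mem_insert_self a s)).mul
      (ih fun i hi => h i (Finset.mem_insert_of_mem hi))

/-- Sums of `ε`-integral fractions are `ε`-integral. [cite: DuttaDwivediSaxena2022, Lemma 2.20 proof (full version p0023 L632–636, p0024 L1–6)] -/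
theorem IsEpsInt.add (h₁ : IsEpsInt T₁) (h₂ : IsEpsInt T₂) : IsEpsInt (T₁ + T₂) := by
  obtain ⟨r₁, h₁⟩ := h₁
  obtain ⟨r₂, h₂⟩ := h₂
  exact (h₁.add h₂).isEpsInt

/-- Products of `ε`-integral fractions are `ε`-integral. [cite: DuttaDwivediSaxena2022, Lemma 2.20 proof (full version p0023 L632–636, p0024 L1–6)] -/
theorem IsEpsInt.mul (h₁ : IsEpsInt T₁) (h₂ : IsEpsInt T₂) : IsEpsInt (T₁ * T₂) := by
  obtain ⟨r₁, h₁⟩ := h₁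
  obtain ⟨r₂, h₂⟩ := h₂
  exact (h₁.mul h₂).isEpsInt

/-- Negatives of `ε`-integral fractions are `ε`-integral. [cite: DuttaDwivediSaxena2022, Lemma 2.20 proof (full version p0023 L632–636, p0024 L1–6)] -/
theorem IsEpsInt.neg (h : IsEpsInt T) : IsEpsInt (-T) := by
  obtain ⟨r, h⟩ := h
  exact h.neg.isEpsInt

/-- Differences of `ε`-integral fractions are `ε`-integral. [cite: DuttaDwivediSaxena2022, Lemma 2.20 proof (full version p0023 L632–636, p0024 L1–6)] -/
theorem IsEpsInt.sub (h₁ : IsEpsInt T₁) (h₂ : IsEpsInt T₂) : IsEpsInt (T₁ - T₂) := by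
  obtain ⟨r₁, h₁⟩ := h₁
  obtain ⟨r₂, h₂⟩ := h₂
  exact (h₁.sub h₂).isEpsInt

/-- Powers of `ε`-integral fractions are `ε`-integral. [cite: DuttaDwivediSaxena2022, Lemma 2.20 proof (full version p0023 L632–636, p0024 L1–6)] -/
theorem IsEpsInt.pow (h : IsEpsInt T) (n : ℕ) : IsEpsInt (T ^ n) := by
  obtain ⟨r, h⟩ := h
  exact (h.pow n).isEpsInt

/-- `lim` is additive. [cite: DuttaDwivediSaxena2022, Lemma 2.20 proof (full version p0023 L632–636, p0024 L1–6)] -/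
theorem IsEpsInt.lim_add (h₁ : IsEpsInt T₁) (h₂ : IsEpsInt T₂) :
    (h₁.add h₂).lim = h₁.lim + h₂.lim :=
  (h₁.add h₂).epsLim_lim.unique (h₁.epsLim_lim.add h₂.epsLim_lim)

/-- `lim` is multiplicative. [cite: DuttaDwivediSaxena2022, Lemma 2.20 proof (full version p0023 L632–636, p0024 L1–6)] -/
theorem IsEpsInt.lim_mul (h₁ : IsEpsInt T₁) (h₂ : IsEpsInt T₂) :
    (h₁.mul h₂).lim = h₁.lim * h₂.lim :=
  (h₁.mul h₂).epsLim_lim.unique (h₁.epsLim_lim.mul h₂.epsLim_lim)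

/-- `lim` commutes with negation. [cite: DuttaDwivediSaxena2022, Lemma 2.20 proof (full version p0023 L632–636, p0024 L1–6)] -/
theorem IsEpsInt.lim_neg (h : IsEpsInt T) : h.neg.lim = -h.lim :=
  h.neg.epsLim_lim.unique h.epsLim_lim.neg

/-- `lim` commutes with subtraction. [cite: DuttaDwivediSaxena2022, Lemma 2.20 proof (full version p0023 L632–636, p0024 L1–6)] -/
theorem IsEpsInt.lim_sub (h₁ : IsEpsInt T₁) (h₂ : IsEpsInt T₂) :
    (h₁.sub h₂).lim = h₁.lim - h₂.lim :=
  (h₁.sub h₂).epsLim_lim.unique (h₁.epsLim_lim.sub h₂.epsLim_lim)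

/-- `lim` commutes with powers. [cite: DuttaDwivediSaxena2022, Lemma 2.20 proof (full version p0023 L632–636, p0024 L1–6)] -/
theorem IsEpsInt.lim_pow (h : IsEpsInt T) (n : ℕ) : (h.pow n).lim = h.lim ^ n :=
  (h.pow n).epsLim_lim.unique (h.epsLim_lim.pow n)

end Ring

/-! ### Division by `ε`-units -/

section Units

variable {F : Type*} [Field F] {σ : Type*}
variable {T T₁ T₂ : FractionRing (MvPolynomial σ (RatFunc F))}
  {r r₁ r₂ : FractionRing (MvPolynomial σ F)}

/-- An `ε`-integral fraction with NONZERO limit is nonzero ("`T̃` … is not divisible by `ε`").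
[cite: DuttaDwivediSaxena2022, §3 DIVIDE step (full version p0030 L808–810)] -/
theorem EpsLim.ne_zero (h : EpsLim T r) (hr : r ≠ 0) : T ≠ 0 := by
  obtain ⟨M, E, hE, hT, hrE⟩ := h
  have hM : redZero F σ M ≠ 0 := (EpsLim.ne_zero_iff_of_model ⟨M, E, hE, hT, hrE⟩ hE hT).mp hr
  intro h0
  rw [h0, zero_mul] at hT
  exact intToFrac_ne_zero (ne_zero_of_redZero_ne_zero hM) hT.symm

/-- **Inverting an `ε`-unit**: if `lim T = r ≠ 0` then `T⁻¹` is `ε`-integral with limit `r⁻¹`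
(model `E/M`, `M(0) ≠ 0`). This is the DIVIDE step's use of the normalised divisor `T̃_{k-j,j}`,
whose limit `t_{k-j,j}` is nonzero. [cite: DuttaDwivediSaxena2022, §3 DIVIDE step (full version p0030 L808–812); Claim 3.4 proof "Φ(f₀)/t_{k,0}" (p0029 L777–779)] -/
theorem EpsLim.inv (h : EpsLim T r) (hr : r ≠ 0) : EpsLim T⁻¹ r⁻¹ := by
  have hT0 : T ≠ 0 := h.ne_zero hr
  obtain ⟨M, E, hE, hT, hrE⟩ := h
  have hM : redZero F σ M ≠ 0 := (EpsLim.ne_zero_iff_of_model ⟨M, E, hE, hT, hrE⟩ hE hT).mp hr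
  refine ⟨E, M, hM, ?_, ?_⟩
  · rw [← hT, inv_mul_cancel_left₀ hT0]
  · rw [← hrE, inv_mul_cancel_left₀ hr]

/-- **Dividing by an `ε`-unit**: `lim (T₁/T₂) = lim T₁ / lim T₂` when `lim T₂ ≠ 0`.
[cite: DuttaDwivediSaxena2022, §3 DIVIDE step (full version p0030 L808–812); Claim 3.4 proof "Φ(f₀)/t_{k,0}" (p0029 L777–779)] -/
theorem EpsLim.div (h₁ : EpsLim T₁ r₁) (h₂ : EpsLim T₂ r₂) (hr₂ : r₂ ≠ 0) :
    EpsLim (T₁ / T₂) (r₁ / r₂) := by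
  rw [div_eq_mul_inv, div_eq_mul_inv]
  exact h₁.mul (h₂.inv hr₂)

/-- **Ratios of integral models**: `M/E` with `E(0) ≠ 0` tends to `M(0)/E(0)` — the shape in
which the tree's `border_mulDiv`/`deborder_gen_one` consume "`lim_{ε→0}` of a ratio".
[cite: DuttaDwivediSaxena2022, Lemma 2.20 (full version p0023 L628–636); Claim 3.3 (p0027 L724–744)] -/
theorem epsLim_intToFrac_div {M E : MvPolynomial σ F[X]} (hE : redZero F σ E ≠ 0) :
    EpsLim (intToFrac F σ M / intToFrac F σ E)
      (limToFrac F σ (redZero F σ M) / limToFrac F σ (redZero F σ E)) :=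
  (epsLim_intToFrac M).div (epsLim_intToFrac E) (limToFrac_ne_zero hE)

/-- Conversely, every `ε`-integral `T` IS such a ratio: `T = M/E` with `E(0) ≠ 0` and
`lim T = M(0)/E(0)`. [cite: DuttaDwivediSaxena2022, Claim 3.3 proof (full version p0027 L729–737)] -/
theorem EpsLim.exists_eq_div (h : EpsLim T r) :
    ∃ M E : MvPolynomial σ F[X], redZero F σ E ≠ 0 ∧ T = intToFrac F σ M / intToFrac F σ E ∧
      r = limToFrac F σ (redZero F σ M) / limToFrac F σ (redZero F σ E) := by
  obtain ⟨M, E, hE, hT, hr⟩ := h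
  refine ⟨M, E, hE, ?_, ?_⟩
  · rw [eq_div_iff (intToFrac_ne_zero (ne_zero_of_redZero_ne_zero hE)), hT]
  · rw [eq_div_iff (limToFrac_ne_zero hE), hr]

/-- Inverses of `ε`-units are `ε`-integral. [cite: DuttaDwivediSaxena2022, §3 DIVIDE step (full version p0030 L808–812)] -/
theorem IsEpsInt.inv (h : IsEpsInt T) (hr : h.lim ≠ 0) : IsEpsInt T⁻¹ :=
  (h.epsLim_lim.inv hr).isEpsInt

/-- `lim (T⁻¹) = (lim T)⁻¹` for an `ε`-unit. [cite: DuttaDwivediSaxena2022, §3 DIVIDE step (full version p0030 L808–812)] -/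
theorem IsEpsInt.lim_inv (h : IsEpsInt T) (hr : h.lim ≠ 0) : (h.inv hr).lim = h.lim⁻¹ :=
  (h.inv hr).epsLim_lim.unique (h.epsLim_lim.inv hr)

/-- Quotients by `ε`-units are `ε`-integral. [cite: DuttaDwivediSaxena2022, §3 DIVIDE step (full version p0030 L808–812)] -/
theorem IsEpsInt.div (h₁ : IsEpsInt T₁) (h₂ : IsEpsInt T₂) (hr : h₂.lim ≠ 0) :
    IsEpsInt (T₁ / T₂) :=
  (h₁.epsLim_lim.div h₂.epsLim_lim hr).isEpsInt

/-- `lim (T₁/T₂) = lim T₁ / lim T₂` for an `ε`-unit `T₂`. [cite: DuttaDwivediSaxena2022, §3 DIVIDE step (full version p0030 L808–812)] -/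
theorem IsEpsInt.lim_div (h₁ : IsEpsInt T₁) (h₂ : IsEpsInt T₂) (hr : h₂.lim ≠ 0) :
    (h₁.div h₂ hr).lim = h₁.lim / h₂.lim :=
  (h₁.div h₂ hr).epsLim_lim.unique (h₁.epsLim_lim.div h₂.epsLim_lim hr)

/-- Scalars with a unit denominator: `p(ε)/q(ε) → p(0)/q(0)` when `q(0) ≠ 0`.
[cite: DuttaDwivediSaxena2022, §2 "Valuation" (full version p0015 L407–410)] -/
theorem epsLim_C_div (p q : F[X]) (hq : q.coeff 0 ≠ 0) :
    EpsLim (algebraMap (MvPolynomial σ (RatFunc F)) (FractionRing (MvPolynomial σ (RatFunc F)))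
        (C (algebraMap F[X] (RatFunc F) p / algebraMap F[X] (RatFunc F) q)))
      (limToFrac F σ (C (p.coeff 0)) / limToFrac F σ (C (q.coeff 0))) := by
  rw [algebraMap_C_div]
  exact (epsLim_C_algebraMap p).div (epsLim_C_algebraMap q)
    (limToFrac_ne_zero (C_ne_zero.mpr hq))

/-- Multiplying by `ε` kills the limit: `lim (ε·T) = 0` (the "`+ ε·S`" terms).
[cite: DuttaDwivediSaxena2022, Def. 2.1 (full version p0016 L416–419); §3 "Φ(g₀) = Φ(f₀) + ε·Φ(S₀)" (p0028 L751–757)] -/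
theorem EpsLim.eps_mul (h : EpsLim T r) :
    EpsLim (algebraMap (MvPolynomial σ (RatFunc F)) (FractionRing (MvPolynomial σ (RatFunc F)))
        (C (algebraMap F[X] (RatFunc F) Polynomial.X)) * T) 0 := by
  have h' := epsLim_eps.mul h
  rwa [zero_mul] at h'

/-- **Normalising a nonzero fraction** ("`T_{k-j,j} =: ε^{a_{k-j,j}}·T̃_{k-j,j}` … `lim_{ε→0} T̃`
exists" and is nonzero, for RATIONAL FUNCTIONS): every nonzero `T ∈ F(ε)(x)` is `T = c · U` with
`c ∈ F(ε)^×` and `U` an `ε`-UNIT (`ε`-integral with nonzero limit) — numerator and denominator of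
`T` put in the tree's `ε`-normal form `exists_epsNormalForm`.
[cite: DuttaDwivediSaxena2022, §3 DIVIDE step (full version p0030 L808–810); Claim 3.3 proof (p0027 L729–733)] -/
theorem exists_unit_normalForm (hT : T ≠ 0) :
    ∃ (c : RatFunc F) (U : FractionRing (MvPolynomial σ (RatFunc F)))
      (u : FractionRing (MvPolynomial σ F)), c ≠ 0 ∧ u ≠ 0 ∧ EpsLim U u ∧
      T = algebraMap (MvPolynomial σ (RatFunc F)) (FractionRing (MvPolynomial σ (RatFunc F)))
        (C c) * U := by
  obtain ⟨a, b, hb, hab⟩ := IsFractionRing.div_surjective (A := MvPolynomial σ (RatFunc F)) T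
  have hb0 : b ≠ 0 := nonZeroDivisors.ne_zero hb
  have ha0 : a ≠ 0 := by
    rintro rfl
    rw [map_zero, zero_div] at hab
    exact hT hab.symm
  obtain ⟨c₁, G₁, hc₁, ha, hG₁⟩ := exists_epsNormalForm a ha0
  obtain ⟨c₂, G₂, hc₂, hb', hG₂⟩ := exists_epsNormalForm b hb0
  rw [← redZero_apply] at hG₁ hG₂
  refine ⟨c₁ / c₂, intToFrac F σ G₁ / intToFrac F σ G₂,
    limToFrac F σ (redZero F σ G₁) / limToFrac F σ (redZero F σ G₂), div_ne_zero hc₁ hc₂,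
    div_ne_zero (limToFrac_ne_zero hG₁) (limToFrac_ne_zero hG₂), epsLim_intToFrac_div hG₂, ?_⟩
  rw [← hab, ha, hb', map_mul, map_mul, ← intToFrac_apply, ← intToFrac_apply, algebraMap_C_div,
    div_mul_div_comm]

end Units

/-! ### Links with the polynomial layer (`IsEpsApprox`, `ε`-normal forms) -/

section Links

variable {F : Type*} [Field F]

/-- **Def. 2.1 ⇒ limit**: if `g = f + ε·S` approximates `f` (`MS2021.IsEpsApprox f g`), then `g`,
read in `F(ε)(x)`, is `ε`-integral with limit `f`.
[cite: DuttaDwivediSaxena2022, Def. 2.1 (full version p0016 L416–419); §3 "Φ(g₀) = Φ(f₀) + ε·Φ(S₀)" (p0028 L751–757)] -/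
theorem epsLim_algebraMap_of_isEpsApprox {n : ℕ} {f : MvPolynomial (Fin n) F}
    {g : MvPolynomial (Fin n) (RatFunc F)} (h : MS2021.IsEpsApprox f g) :
    EpsLim (algebraMap (MvPolynomial (Fin n) (RatFunc F))
        (FractionRing (MvPolynomial (Fin n) (RatFunc F))) g)
      (limToFrac F (Fin n) f) := by
  obtain ⟨G, hGg, hGf⟩ := isEpsApprox_iff_exists_map.mp h
  have hG := epsLim_intToFrac (F := F) (σ := Fin n) G
  rwa [intToFrac_apply, hGg, redZero_apply, hGf] at hG

variable {σ : Type*} {T : FractionRing (MvPolynomial σ (RatFunc F))}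
  {r : FractionRing (MvPolynomial σ F)}

/-- Pulling an identity of integral models back from `F(ε)(x)` to `F(ε)[x]`. (folklore) [cite: DuttaDwivediSaxena2022, §2 "Valuation" (full version p0015 L407–410)] -/
theorem algebraMap_fractionRing_injective :
    Function.Injective (algebraMap (MvPolynomial σ (RatFunc F))
      (FractionRing (MvPolynomial σ (RatFunc F)))) :=
  IsFractionRing.injective _ _

/-- **Limit of an `ε`-normal form**: if `T = c · Ĝ` (`c ∈ F(ε)^×`, `Ĝ ∈ F[ε][x]`, `Ĝ(0) ≠ 0`,
the tree's `exists_epsNormalForm`) is `ε`-integral with limit `r`, then `r = u · Ĝ(0)` for a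
scalar `u ∈ F`, nonzero exactly when `r ≠ 0` ("`T = ε^{a}·T̃`": `a ≥ 0`; `a ≥ 1 ⇒` limit `0`;
`a = 0 ⇒` limit = (unit)·`T̃(0)`). From the tree's `exists_limit_ratio`.
[cite: DuttaDwivediSaxena2022, Claim 3.3 proof (full version p0027 L729–737)] -/
theorem EpsLim.exists_eq_C_mul_of_normalForm {c : RatFunc F} (hc : c ≠ 0)
    {G : MvPolynomial σ F[X]} (hG : redZero F σ G ≠ 0)
    (h : EpsLim (algebraMap (MvPolynomial σ (RatFunc F))
        (FractionRing (MvPolynomial σ (RatFunc F)))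
          (C c * map (algebraMap F[X] (RatFunc F)) G)) r) :
    ∃ u : F, r = limToFrac F σ (C u * redZero F σ G) ∧ (r ≠ 0 → u ≠ 0) := by
  obtain ⟨M, E, hE, hT, hrE⟩ := h
  -- the identity `c · (G E) = M` over `F(ε)[x]`
  have hGE : redZero F σ (G * E) ≠ 0 := by
    rw [map_mul]
    exact mul_ne_zero hG hE
  have key : C c * map (algebraMap F[X] (RatFunc F)) (G * E) =
      map (algebraMap F[X] (RatFunc F)) M := by
    apply algebraMap_fractionRing_injective
    rw [map_mul (map (algebraMap F[X] (RatFunc F))) G E, ← mul_assoc, map_mul, ← intToFrac_apply,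
      hT, intToFrac_apply]
  obtain ⟨u, hu, hu0⟩ := exists_limit_ratio hc (by rwa [redZero_apply] at hGE) key
  rw [← redZero_apply, ← redZero_apply, map_mul, ← mul_assoc] at hu
  -- `r · E(0) = M(0) = u · G(0) · E(0)`
  have hr : r = limToFrac F σ (C u * redZero F σ G) := by
    apply mul_right_cancel₀ (limToFrac_ne_zero hE)
    rw [hrE, hu, map_mul]
  refine ⟨u, hr, fun hr0 => hu0 ?_⟩
  change redZero F σ M ≠ 0
  intro hM
  rw [hM, map_zero] at hrE
  exact mul_ne_zero hr0 (limToFrac_ne_zero hE) hrE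

/-- **`ε`-integrality forces nonnegative order**: if `T = c · Ĝ` as above is `ε`-integral then
`c · q(ε) = ε^{a} · p(ε)` with `p(0) q(0) ≠ 0` for some `a : ℕ` ("Since the left side … is
well-defined at `ε = 0`, it must happen that `val_ε ≥ 0`"). From the tree's
`exists_ord_of_C_mul_map_eq_map`. [cite: DuttaDwivediSaxena2022, Claim 3.3 proof (full version p0027 L733–735)] -/
theorem IsEpsInt.exists_ord_of_normalForm {c : RatFunc F} (hc : c ≠ 0)
    {G : MvPolynomial σ F[X]} (hG : redZero F σ G ≠ 0)
    (h : IsEpsInt (algebraMap (MvPolynomial σ (RatFunc F))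
        (FractionRing (MvPolynomial σ (RatFunc F)))
          (C c * map (algebraMap F[X] (RatFunc F)) G))) :
    ∃ (a : ℕ) (p q : F[X]), p.coeff 0 ≠ 0 ∧ q.coeff 0 ≠ 0 ∧
      c * algebraMap F[X] (RatFunc F) q = algebraMap F[X] (RatFunc F) (Polynomial.X ^ a * p) := by
  obtain ⟨r, M, E, hE, hT, -⟩ := h
  have hGE : redZero F σ (G * E) ≠ 0 := by
    rw [map_mul]
    exact mul_ne_zero hG hE
  have key : C c * map (algebraMap F[X] (RatFunc F)) (G * E) =
      map (algebraMap F[X] (RatFunc F)) M := by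
    apply algebraMap_fractionRing_injective
    rw [map_mul (map (algebraMap F[X] (RatFunc F))) G E, ← mul_assoc, map_mul, ← intToFrac_apply,
      hT, intToFrac_apply]
  obtain ⟨a, p, q, hp, hq, hcq, -⟩ :=
    exists_ord_of_C_mul_map_eq_map hc (by rwa [redZero_apply] at hGE) key
  exact ⟨a, p, q, hp, hq, hcq⟩

end Links

end DDS2021

end Literature.Computability.AlgebraicComplexity

end
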